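import Summits.HubbardSuperconductivity.HubbardSuperconductivity.Theorems.TwSourcedInertness.Negative.FreeGain
import Literature.MathematicalPhysics.QuantumLattice.TorusCooperSum
import Literature.MathematicalPhysics.QuantumLattice.TorusCooperSumRowWalk
import Literature.MathematicalPhysics.QuantumLattice.DWaveSourceFreeGainBound

/-!
# Crux `TwSourcedInertness` (item `stmt-HubbardSuperconductivity-1696`): the per-level convexity
# bound and the harmonic row walk with a THERMAL cutoff

Two inputs for the sharpness of the `log β` in the crux (sibling `ThermalCooperLog`):

* `sub_div_le_bdgF_sub` — for `1 ≤ a ≤ b`, `b − a ≤ 16`: `(b − a)/19 ≤ F(b) − F(a)`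
  (`F(y) = log((1+cosh y)/2)`; supporting line of `cosh`, `sinh a/(1 + cosh a) ≥ 1/3` for `a ≥ 1`,
  Mathlib's `1 − y⁻¹ ≤ log y`), hence `modeGain_thermal_lower_bound`: at `h = 1/β`, `β ≥ 1`, every level with
  `|ξ_k| ≥ 1/β` gains at least `ĝ_d(k)²/(19β|ξ_k|)`;
* `cooperRow_thermal_sum_ge` — for row energies `g(n) = −2cos(2πn/L) + c`, `|c| ≤ 3/2`, `L ≥ 400`,
  `β ≥ 128`, `L ≥ 2β`: `Σ_{n < L : 1/β ≤ g(n)} 1/g(n) ≥ (L/(4π))(log β − log 128)` — the tree's row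
  walk (`exists_cooperRow_crossing`, `cooperRow_walk_bounds`) restricted to `j ∈ [⌈L/β⌉, ⌊L/64⌋]`:
  the TEMPERATURE, not the level spacing, is the infrared cutoff.

Sources: M. Salmhofer, *Renormalization* (1999) §4.5.4 (Cooper logarithm); tree
`TorusCooperSumRowWalk`; folklore real analysis.
-/

noncomputable section

namespace Summit.HubbardSuperconductivity.HubbardSuperconductivity.Theorems.TwSourcedInertness.Negative

open Matrix Finset Literature.MathematicalPhysics.QuantumLattice Literature.Probability.LatticeModels

/-! ## LOAD-BEARING: the `log β` cannot be dropped (thermodynamic regime `L ≫ β`)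

The crux with the bound `C·h²` in place of `C(1+log β)h²` (a STRONGER statement) is FALSE
(`tw1696_noLog_false`), and so is its restriction to the thermal disc `|h| ≤ 1/β`
(`tw1696_noLog_disc_false`): at `μ = −2`, `h = 1/β`, on every torus with `L ≥ 2β` (and
`L ≥ 400`) the FREE gain is at least `(log β − log 128)/(2736π β²)` — the Cooper logarithm with the
temperature (not the level spacing) as infrared cutoff, obtained from the tree's row walk
(`exists_cooperRow_crossing`, `cooperRow_walk_bounds`) restricted to energies `ξ ≥ 1/β` on the
`≥ L/9` rows `cos k₂ ≥ 3/4` (where `|ĝ_d| ≥ 1/2` on the whole positive-`ξ` side), and the per-level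
convexity bound `F(βE) − F(βξ) ≥ ĝ_d²/(19β|ξ|)` for `|ξ| ≥ 1/β`; the interacting gain follows up to
`2U`. MESSAGE TO PROVERS: the `β`-dependence `log β` of the crux's constant is SHARP (tight up to the
value of `C`); any proof must produce the Cooper logarithm, and the thermal-disc stub inherits it. -/

section LogLoadBearing

/-- Supporting line of `cosh`: `(b − a) sinh a ≤ cosh b − cosh a` for `a ≤ b`. -/
theorem sub_mul_sinh_le_cosh_sub_cosh {a b : ℝ} (hab : a ≤ b) :
    (b - a) * Real.sinh a ≤ Real.cosh b - Real.cosh a := by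
  have hd0 : 0 ≤ b - a := by linarith
  have hb : b = a + (b - a) := by ring
  have h1 : (b - a) + 1 ≤ Real.exp (b - a) := Real.add_one_le_exp _
  have h2 : -(b - a) + 1 ≤ Real.exp (-(b - a)) := Real.add_one_le_exp _
  have hea : 0 < Real.exp a := Real.exp_pos a
  have hena : 0 < Real.exp (-a) := Real.exp_pos (-a)
  have hexpb : Real.exp b = Real.exp a * Real.exp (b - a) := by rw [← Real.exp_add]; ring_nf
  have hexpnb : Real.exp (-b) = Real.exp (-a) * Real.exp (-(b - a)) := by
    rw [← Real.exp_add]; ring_nf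
  rw [Real.sinh_eq, Real.cosh_eq, Real.cosh_eq, hexpb, hexpnb]
  have k1 := mul_le_mul_of_nonneg_left h1 hea.le
  have k2 := mul_le_mul_of_nonneg_left h2 hena.le
  nlinarith

/-- For `a ≥ 1`: `1/3 ≤ sinh a/(1 + cosh a)` (`cosh a − sinh a = e^{−a} ≤ 1`, `sinh a ≥ a ≥ 1`). -/
theorem third_le_sinh_div_one_add_cosh {a : ℝ} (ha : 1 ≤ a) :
    1 / 3 ≤ Real.sinh a / (1 + Real.cosh a) := by
  have hc := Real.one_le_cosh a
  have hs : a ≤ Real.sinh a := Real.self_le_sinh_iff.mpr (by linarith)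
  have hcs : Real.cosh a - Real.sinh a = Real.exp (-a) := Real.cosh_sub_sinh a
  have he : Real.exp (-a) ≤ 1 := by rw [Real.exp_le_one_iff]; linarith
  rw [div_le_div_iff₀ (by norm_num) (by linarith)]
  linarith

/-- **Per-level convexity bound**: `(b − a)/19 ≤ F(b) − F(a)` for `1 ≤ a ≤ b`, `b − a ≤ 16`. -/
theorem sub_div_le_bdgF_sub {a b : ℝ} (ha : 1 ≤ a) (hab : a ≤ b) (hba : b - a ≤ 16) :
    (b - a) / 19 ≤ Real.log ((1 + Real.cosh b) / 2) - Real.log ((1 + Real.cosh a) / 2) := by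
  have hApos := bdgF_arg_pos a
  have hBpos := bdgF_arg_pos b
  have hca : 0 < 1 + Real.cosh a := by have := Real.one_le_cosh a; linarith
  rw [← Real.log_div hBpos.ne' hApos.ne']
  have e : (1 + Real.cosh b) / 2 / ((1 + Real.cosh a) / 2) = (1 + Real.cosh b) / (1 + Real.cosh a) := by
    field_simp
  rw [e]
  set x : ℝ := (b - a) / 3 with hx
  have hx0 : 0 ≤ x := by rw [hx]; linarith
  have hx16 : x ≤ 16 / 3 := by rw [hx]; linarith
  have hratio : 1 + x ≤ (1 + Real.cosh b) / (1 + Real.cosh a) := by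
    rw [le_div_iff₀ hca]
    have h1 := sub_mul_sinh_le_cosh_sub_cosh hab
    have h2 := third_le_sinh_div_one_add_cosh ha
    rw [div_le_div_iff₀ (by norm_num) hca] at h2
    have hd0 : 0 ≤ b - a := by linarith
    have h3 : (b - a) * (1 * (1 + Real.cosh a)) ≤ (b - a) * (Real.sinh a * 3) :=
      mul_le_mul_of_nonneg_left h2 hd0
    rw [hx]
    nlinarith
  have hlog1 : Real.log (1 + x) ≤ Real.log ((1 + Real.cosh b) / (1 + Real.cosh a)) :=
    Real.log_le_log (by linarith) hratio
  have hlog2 : x / (1 + x) ≤ Real.log (1 + x) := by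
    have h1x : 0 < 1 + x := by linarith
    have h := Real.one_sub_inv_le_log_of_pos h1x
    have e : 1 - (1 + x)⁻¹ = x / (1 + x) := by field_simp; ring
    rw [e] at h
    exact h
  have hlow : x / (19 / 3) ≤ x / (1 + x) :=
    div_le_div_of_nonneg_left hx0 (by linarith) (by linarith)
  have e2 : x / (19 / 3) = (b - a) / 19 := by rw [hx]; ring
  linarith

/-- **Per-mode thermal bound**: for `β ≥ 1`, `h = 1/β` and a level with `|ξ_k| ≥ 1/β`,
`ĝ_d(k)²/(19β|ξ_k|) ≤ modeGain`. -/
theorem modeGain_thermal_lower_bound {L : ℕ} [NeZero L] {β : ℝ} (hβ : 1 ≤ β) (μ : ℝ) (k : TorusSite 2 L)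
    (hξ : 1 / β ≤ |torusBand L k - μ|) :
    dWaveGap k ^ 2 / (19 * β * |torusBand L k - μ|) ≤ (Real.log ((1 + Real.cosh (β * Real.sqrt ((torusBand L k - μ) ^ 2 + (2 * Real.sqrt 2 * (1 / β) * dWaveGap k) ^ 2))) / 2) - Real.log ((1 + Real.cosh (β * (torusBand L k - μ))) / 2)) := by
  have hβ0 : 0 < β := by linarith
  set ξ : ℝ := torusBand L k - μ with hξdef
  set x : ℝ := |ξ| with hxdef
  set gk : ℝ := dWaveGap k with hgk
  have hx0 : 0 < x := lt_of_lt_of_le (by positivity) hξ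
  have hβx : 1 ≤ β * x := by
    have := mul_le_mul_of_nonneg_left hξ hβ0.le
    rwa [mul_one_div_cancel hβ0.ne'] at this
  set D : ℝ := 2 * Real.sqrt 2 * (1 / β) * gk with hD
  have hD2 : D ^ 2 = 8 * gk ^ 2 / β ^ 2 := by
    rw [hD, mul_pow, mul_pow, mul_pow, Real.sq_sqrt (by norm_num : (0:ℝ) ≤ 2)]
    field_simp
    ring
  have hg2 : gk ^ 2 ≤ 4 := by
    have := abs_dWaveGap_le_two k
    rw [← hgk] at this
    nlinarith [abs_nonneg gk, sq_abs gk]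
  have hD2le : D ^ 2 ≤ 32 * x ^ 2 := by
    rw [hD2]
    have h1 : 1 / β ^ 2 ≤ x ^ 2 := by
      have := pow_le_pow_left₀ (by positivity) hξ 2
      rwa [_root_.one_div_pow] at this
    calc 8 * gk ^ 2 / β ^ 2 = 8 * gk ^ 2 * (1 / β ^ 2) := by ring
      _ ≤ 8 * 4 * x ^ 2 := by
          have := mul_le_mul (mul_le_mul_of_nonneg_left hg2 (by norm_num : (0:ℝ) ≤ 8)) h1
            (by positivity) (by positivity)
          linarith
      _ = 32 * x ^ 2 := by ring
  set E : ℝ := Real.sqrt (ξ ^ 2 + D ^ 2) with hE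
  have hE0 : 0 ≤ E := Real.sqrt_nonneg _
  have hEsq : E ^ 2 = ξ ^ 2 + D ^ 2 := Real.sq_sqrt (by positivity)
  have hx2 : x ^ 2 = ξ ^ 2 := sq_abs ξ
  have hxE : x ≤ E := by
    rw [hxdef, ← Real.sqrt_sq_eq_abs, hE]
    exact Real.sqrt_le_sqrt (by nlinarith)
  have hE7 : E ≤ 7 * x := by
    have h49 : ξ ^ 2 + D ^ 2 ≤ (7 * x) ^ 2 := by nlinarith
    calc E = Real.sqrt (ξ ^ 2 + D ^ 2) := hE
      _ ≤ Real.sqrt ((7 * x) ^ 2) := Real.sqrt_le_sqrt h49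
      _ = 7 * x := Real.sqrt_sq (by positivity)
  -- `E − x` two-sided
  have hprod : (E - x) * (E + x) = D ^ 2 := by nlinarith
  have hlow : D ^ 2 / (8 * x) ≤ E - x := by
    rw [div_le_iff₀ (by positivity)]
    nlinarith
  have hup : E - x ≤ 16 / (β ^ 2 * x) := by
    rw [le_div_iff₀ (by positivity)]
    have : (E - x) * (2 * x) ≤ D ^ 2 := by nlinarith
    have hD32 : D ^ 2 ≤ 32 / β ^ 2 := by
      rw [hD2, div_le_div_iff_of_pos_right (by positivity)]; linarith
    rw [le_div_iff₀ (by positivity)] at hD32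
    nlinarith
  -- apply the per-level bound with `a = βx`, `b = βE`
  have hab : β * x ≤ β * E := mul_le_mul_of_nonneg_left hxE hβ0.le
  have hba : β * E - β * x ≤ 16 := by
    rw [← mul_sub]
    calc β * (E - x) ≤ β * (16 / (β ^ 2 * x)) := by gcongr
      _ = 16 / (β * x) := by field_simp
      _ ≤ 16 / 1 := div_le_div_of_nonneg_left (by norm_num) one_pos hβx
      _ = 16 := by norm_num
  have key := sub_div_le_bdgF_sub hβx hab hba
  have hmg : (Real.log ((1 + Real.cosh (β * Real.sqrt ((torusBand L k - μ) ^ 2 + (2 * Real.sqrt 2 * (1 / β) * dWaveGap k) ^ 2))) / 2) - Real.log ((1 + Real.cosh (β * (torusBand L k - μ))) / 2)) = Real.log ((1 + Real.cosh (β * E)) / 2) - Real.log ((1 + Real.cosh (β * x)) / 2) := by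
    rw [← hξdef, ← hgk, ← hD, ← hE]
    congr 1
    rw [← Real.cosh_abs (β * ξ), abs_mul, abs_of_pos hβ0, hxdef]
  rw [hmg]
  refine le_trans ?_ key
  -- `gk²/(19βx) ≤ β(E − x)/19`
  rw [← mul_sub]
  have h1 : gk ^ 2 / (19 * β * x) = β * (D ^ 2 / (8 * x)) / 19 := by
    rw [hD2]; field_simp
  rw [h1]
  gcongr


/-! ### J.2 The harmonic walk along one row with a thermal cutoff -/

/-- **One row, thermal cutoff.** For `|c| ≤ 3/2`, `L ≥ 400`, `β ≥ 128`, `L ≥ 2β`, the row energies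
`g(n) = −2cos(2πn/L) + c` satisfy `Σ_{n < L : 1/β ≤ g(n)} 1/g(n) ≥ (L/(4π))(log β − log 128)`
(tree: `exists_cooperRow_crossing`, `cooperRow_walk_bounds`; the walk `j ∈ [⌈L/β⌉, ⌊L/64⌋]`). -/
theorem cooperRow_thermal_sum_ge {L : ℕ} {c β : ℝ} (g : ℕ → ℝ)
    (hg : ∀ n : ℕ, g n = -2 * Real.cos (2 * Real.pi * (n : ℝ) / L) + c) (hc : |c| ≤ 3 / 2)
    (hL : (400 : ℝ) ≤ L) (hβ : 128 ≤ β) (hLβ : 2 * β ≤ L) :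
    (L : ℝ) / (4 * Real.pi) * (Real.log β - Real.log 128) ≤
      ∑ n ∈ (Finset.range L).filter (fun n : ℕ => 1 / β ≤ g n), 1 / g n := by
  have hπ := Real.pi_pos
  have hβ0 : 0 < β := by linarith
  have hLr : (0 : ℝ) < L := by linarith
  have hs : (0 : ℝ) < 1 := one_pos
  have hc' : |c| ≤ 2 - (1 : ℝ) ^ 2 / 2 := by norm_num; linarith
  have hL' : 400 / (1 : ℝ) ^ 2 ≤ (L : ℝ) := by rw [one_pow, div_one]; exact hL
  obtain ⟨n₀, _hn₀1, hn₀L, hg0, hg1, hcos⟩ := exists_cooperRow_crossing (c := c) hs le_rfl hc' hL'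
  -- walk length and first index
  set R : ℕ := ⌊(L : ℝ) / 64⌋₊ with hR
  have hRle : (R : ℝ) ≤ (1 : ℝ) ^ 2 * L / 64 := by
    rw [one_pow, one_mul]; exact Nat.floor_le (by positivity)
  have hRge : (L : ℝ) / 64 < R + 1 := Nat.lt_floor_add_one _
  set j₀ : ℕ := ⌈(L : ℝ) / β⌉₊ with hj₀
  have hj₀ge : (L : ℝ) / β ≤ j₀ := Nat.le_ceil _
  have hj₀lt : (j₀ : ℝ) < L / β + 1 := Nat.ceil_lt_add_one (by positivity)
  have hLβ' : 2 ≤ (L : ℝ) / β := by rw [le_div_iff₀ hβ0]; linarith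
  have hLβ128 : (L : ℝ) / β ≤ L / 128 := div_le_div_of_nonneg_left hLr.le (by norm_num) hβ
  have hL128 : (1 : ℝ) ≤ L / 128 := by rw [le_div_iff₀ (by norm_num)]; linarith
  have hj₀R : j₀ ≤ R := by
    have h1 : (j₀ : ℝ) < R + 1 := by
      have : (L : ℝ) / 64 = L / 128 + L / 128 := by ring
      linarith
    have h2 : j₀ < R + 1 := by exact_mod_cast h1
    omega
  -- along the walk: `1/β ≤ g ≤ 4π(j+1)/L`
  have hwalk : ∀ j ∈ Finset.Ico j₀ (R + 1),
      1 / β ≤ g (n₀ + j) ∧ g (n₀ + j) ≤ 4 * Real.pi * (j + 1) / L := by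
    intro j hj
    rw [Finset.mem_Ico] at hj
    have hjR : j ≤ R := by omega
    obtain ⟨hb1, hb2⟩ := cooperRow_walk_bounds (c := c) hs le_rfl hL' hn₀L hcos hRle hg0 hg1 hjR
    rw [← hg (n₀ + j)] at hb1 hb2
    refine ⟨?_, hb2⟩
    have hj1 : (j₀ : ℝ) ≤ j := by exact_mod_cast hj.1
    calc 1 / β = (L / β) / L := by field_simp
      _ ≤ (j₀ : ℝ) / L := by gcongr
      _ ≤ 1 * (j : ℝ) / L := by rw [one_mul]; gcongr
      _ ≤ g (n₀ + j) := hb1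
  -- the walk lies in the summation range
  have hsub : (Finset.Ico j₀ (R + 1)).image (fun j => n₀ + j) ⊆
      (Finset.range L).filter (fun n : ℕ => 1 / β ≤ g n) := by
    intro n hn
    rw [Finset.mem_image] at hn
    obtain ⟨j, hj, rfl⟩ := hn
    have hw := hwalk j hj
    rw [Finset.mem_Ico] at hj
    rw [Finset.mem_filter, Finset.mem_range]
    refine ⟨?_, hw.1⟩
    have hjR : (j : ℝ) ≤ L / 64 := by
      have : (j : ℝ) ≤ R := by exact_mod_cast (show j ≤ R by omega)
      rw [one_pow, one_mul] at hRle
      linarith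
    have h2n : 2 * (n₀ : ℝ) ≤ L := by exact_mod_cast hn₀L
    have : (n₀ : ℝ) + j < L := by linarith
    exact_mod_cast this
  have hinj : Set.InjOn (fun j => n₀ + j) ↑(Finset.Ico j₀ (R + 1)) := fun a _ b _ h => by
    simpa using h
  -- the harmonic sum
  have hharm : Real.log β - Real.log 128 ≤ ∑ j ∈ Finset.Ico j₀ (R + 1), 1 / ((j : ℝ) + 1) := by
    have h1 : 1 ≤ j₀ + 1 := by omega
    have h2 : j₀ + 1 ≤ R + 2 := by omega
    have key := log_sub_log_le_sum_Ico_one_div h1 h2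
    have hre : ∑ i ∈ Finset.Ico (j₀ + 1) (R + 2), (1 : ℝ) / i =
        ∑ j ∈ Finset.Ico j₀ (R + 1), 1 / ((j : ℝ) + 1) := by
      rw [Finset.sum_Ico_eq_sum_range, Finset.sum_Ico_eq_sum_range,
        show R + 2 - (j₀ + 1) = R + 1 - j₀ by omega]
      refine Finset.sum_congr rfl fun k _ => ?_
      push_cast
      ring
    rw [hre] at key
    -- `log β − log 128 = log(L/64) − log(2L/β) ≤ log(R+2) − log(j₀+1)`
    have hA : Real.log ((L : ℝ) / 64) ≤ Real.log ((R + 2 : ℕ) : ℝ) := by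
      refine Real.log_le_log (by positivity) ?_
      push_cast; linarith
    have hB : Real.log ((j₀ + 1 : ℕ) : ℝ) ≤ Real.log (2 * L / β) := by
      refine Real.log_le_log (by positivity) ?_
      have e2 : (2 : ℝ) * L / β = L / β + L / β := by ring
      push_cast; linarith
    have hC : Real.log ((L : ℝ) / 64) - Real.log (2 * L / β) = Real.log β - Real.log 128 := by
      rw [← Real.log_div (by positivity) (by positivity), ← Real.log_div hβ0.ne' (by norm_num)]
      congr 1
      field_simp
      ring
    linarith
  -- the chain
  calc (L : ℝ) / (4 * Real.pi) * (Real.log β - Real.log 128)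
      ≤ (L : ℝ) / (4 * Real.pi) * ∑ j ∈ Finset.Ico j₀ (R + 1), 1 / ((j : ℝ) + 1) :=
        mul_le_mul_of_nonneg_left hharm (by positivity)
    _ = ∑ j ∈ Finset.Ico j₀ (R + 1), (L : ℝ) / (4 * Real.pi) * (1 / ((j : ℝ) + 1)) := by
        rw [Finset.mul_sum]
    _ ≤ ∑ j ∈ Finset.Ico j₀ (R + 1), 1 / g (n₀ + j) := by
        refine Finset.sum_le_sum fun j hj => ?_
        obtain ⟨h1, h2⟩ := hwalk j hj
        have hgpos : 0 < g (n₀ + j) := lt_of_lt_of_le (by positivity) h1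
        rw [show (L : ℝ) / (4 * Real.pi) * (1 / ((j : ℝ) + 1)) = 1 / (4 * Real.pi * (j + 1) / L) by
          field_simp]
        exact one_div_le_one_div_of_le hgpos h2
    _ = ∑ n ∈ (Finset.Ico j₀ (R + 1)).image (fun j => n₀ + j), 1 / g n := by
        rw [Finset.sum_image hinj]
    _ ≤ ∑ n ∈ (Finset.range L).filter (fun n : ℕ => 1 / β ≤ g n), 1 / g n :=
        Finset.sum_le_sum_of_subset_of_nonneg hsub fun n hn _ => by
          rw [Finset.mem_filter] at hn
          have : 0 < g n := lt_of_lt_of_le (by positivity) hn.2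
          positivity

end LogLoadBearing

end Summit.HubbardSuperconductivity.HubbardSuperconductivity.Theorems.TwSourcedInertness.Negative
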